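import Literature.LinearAlgebra.Alternating.ExteriorPowerBaseChange
import Mathlib.RingTheory.Spectrum.Prime.FreeLocus
import Mathlib.RingTheory.LocalRing.Module
import Mathlib.RingTheory.Flat.Stability
import Mathlib.Algebra.Module.Projective
import HarnessLib

/-!
# Exterior powers of projective modules: base change, projectivity and rank
# (Bourbaki, *Algebra* III §7 no. 5 Prop. 8 beyond the free case; *Commutative Algebra* II §5 no. 3)

Layer `Literature/LinearAlgebra/Alternating`, namespace `Literature.LinearAlgebra.Alternating`.  THEOREMS ONLY
(no definition, no instance, no named fact, no `sorry`) over ★ `ExteriorPowerBaseChange` (`exteriorPowerBaseChange R A n M :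
A ⊗[R] ⋀[R]^n M →ₗ[A] ⋀[A]^n (A ⊗[R] M)`, bijective for FREE `M`); NO named fact, no `sorry`.

* §1 `exteriorPowerBaseChange_surjective` — `θ` is surjective for EVERY module `M` (the `∧ⱼ (1 ⊗ mⱼ)` span
  `⋀ⁿ_A (A ⊗_R M)` because the `1 ⊗ m` span `A ⊗_R M` over `A`).
* §2 `exteriorPowerBaseChange_bijective_of_retract` — if `M` is a retract of a module `F` for which `θ_F` is
  bijective then `θ_M` is bijective (naturality ★ `exteriorPowerBaseChange_comp_baseChange_map` makes `θ_M` a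
  retract of `θ_F`); hence **`exteriorPowerBaseChange_bijective_of_projective`**: Prop. 8 for PROJECTIVE `M`
  (a projective module is a retract of the free module `M →₀ R`, Mathlib `Module.projective_def'`); consumers take
  `LinearEquiv.ofBijective _ (exteriorPowerBaseChange_bijective_of_projective R A n M)`.  In particular exterior powers of projective modules commute with
  localisation.
* §3 `exteriorPower_projective` — `⋀ⁿ_R M` is projective for `M` projective (retract of `⋀ⁿ_R (M →₀ R)`, free by
  Mathlib `exteriorPower.instFree`); with Mathlib `exteriorPower.instFinite` it is finite projective for `M`
  finite projective.
* §4 **`rankAtStalk_exteriorPower`** — for `M` finite projective and a prime `𝔭`,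
  `rankAtStalk (⋀ⁿ_R M) 𝔭 = (rankAtStalk M 𝔭).choose n` (Mathlib `rankAtStalk_eq_finrank_tensorProduct`, §2 at
  `R → R_𝔭`, `R_𝔭 ⊗ M` free over the local ring `R_𝔭` by Mathlib `Module.free_of_flat_of_isLocalRing`, and Mathlib
  `exteriorPower.finrank_eq`).  For `n = rank`: the top exterior power of a finite projective module of constant
  rank `k` is an invertible module (constant rank `1`) — the determinant bundle used by the Plücker embedding
  (cell `hodgecm-mathlib`, F-DAG hand «Plücker», consumer `Motives/GrassmannianPluckerMap`).

Mathlib has `exteriorPower.map_injective/_surjective`, `instFree`, `instFinite`, `finrank_eq`; it has no base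
change of exterior powers (★ tree file, free case) and no statement about exterior powers of projective modules.
Count-neutral Mathlib-side capital; nothing here is about HC — HC_CM is proved only modulo the 7 printed citations
until rung 0 closes.

## References
* N. Bourbaki, *Algebra I, Chapters 1–3*, Springer (1989), Ch. III §7 no. 5 Prop. 8 (base change of the exterior
  algebra, arbitrary module), Ch. II §5 no. 3 (localisation of free/projective modules). [BourbakiAlgebraI1989]
* N. Bourbaki, *Commutative Algebra, Chapters 1–7*, Springer (1989), Ch. II §5 no. 2 Thm. 1 (finite projective =
  finitely presented and locally free), no. 3 Déf. 1 / Thm. 2 and formula (5) `rg_𝔭(⋀ᵏ E) = binom(rg_𝔭 E, k)` (held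
  French text `book:bourbaki2006-algebre-commutative`, chunk p0117). [Bourbaki1989CommAlg]
* The Stacks project, Tag 00DM (finite projective modules are finite locally free). [StacksProject]
-/

noncomputable section

open scoped TensorProduct
open Function Module TensorProduct

namespace Literature.LinearAlgebra.Alternating

/-! ### §1 `θ` is surjective for every module -/

section Surjective

variable (R A : Type*) [CommRing R] [CommRing A] [Algebra R A] (n : ℕ) (M : Type*) [AddCommGroup M]
  [Module R M]

/-- **`θ : A ⊗_R ⋀ⁿ_R M → ⋀ⁿ_A (A ⊗_R M)` is surjective for every `R`-module `M`**: the decomposables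
`(1 ⊗ m₁) ∧ ⋯ ∧ (1 ⊗ mₙ) = θ (1 ⊗ (m₁ ∧ ⋯ ∧ mₙ))` span the target over `A`, since the `1 ⊗ m` span `A ⊗_R M`
over `A` (Mathlib `exteriorPower.ιMulti_span_of_span`).
[cite: BourbakiAlgebraI1989, Ch. III §7 no. 5 Prop. 8] -/
theorem exteriorPowerBaseChange_surjective : Surjective (exteriorPowerBaseChange R A n M) := by
  rw [← LinearMap.range_eq_top, eq_top_iff]
  have hs : Submodule.span A (Set.range (TensorProduct.mk R A M 1)) = ⊤ := by
    rw [← Set.image_univ, ← Submodule.baseChange_span, Submodule.span_univ, Submodule.baseChange_top]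
  rw [← exteriorPower.ιMulti_span_of_span A n (A ⊗[R] M) hs, Submodule.span_le]
  rintro _ ⟨v, hv, rfl⟩
  choose m hm using fun j => hv ⟨j, rfl⟩
  refine ⟨(1 : A) ⊗ₜ[R] exteriorPower.ιMulti R n m, ?_⟩
  rw [exteriorPowerBaseChange_one_tmul_ιMulti]
  congr 1
  funext j
  exact hm j

end Surjective

/-! ### §2 `θ` is bijective for retracts of free modules, i.e. for projective modules -/

section Retract

variable {R A : Type*} [CommRing R] [CommRing A] [Algebra R A] {n : ℕ} {M : Type*} [AddCommGroup M]
  [Module R M] {F : Type*} [AddCommGroup F] [Module R F]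

/-- **A retract of a module with bijective `θ` has bijective `θ`.**  If `i : M → F`, `r : F → M`, `r ∘ i = id`
and `θ_F : A ⊗_R ⋀ⁿ_R F → ⋀ⁿ_A (A ⊗_R F)` is bijective, then so is `θ_M`: by naturality
(★ `exteriorPowerBaseChange_comp_baseChange_map`) `θ_M` is a retract of `θ_F` in the arrow category.
[cite: BourbakiAlgebraI1989, Ch. III §7 no. 5 (the commutative diagram before Prop. 8)] -/
theorem exteriorPowerBaseChange_bijective_of_retract (i : M →ₗ[R] F) (r : F →ₗ[R] M)
    (hri : r ∘ₗ i = LinearMap.id) (hF : Bijective (exteriorPowerBaseChange R A n F)) :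
    Bijective (exteriorPowerBaseChange R A n M) := by
  have h1 : ∀ x, exteriorPowerBaseChange R A n F ((exteriorPower.map n i).baseChange A x) =
      exteriorPower.map n (i.baseChange A) (exteriorPowerBaseChange R A n M x) :=
    exteriorPowerBaseChange_baseChange_map R A i
  have h2 : ∀ y, exteriorPowerBaseChange R A n M ((exteriorPower.map n r).baseChange A y) =
      exteriorPower.map n (r.baseChange A) (exteriorPowerBaseChange R A n F y) :=
    exteriorPowerBaseChange_baseChange_map R A r
  have hup : ∀ x : A ⊗[R] ⋀[R]^n M,
      (exteriorPower.map n r).baseChange A ((exteriorPower.map n i).baseChange A x) = x := fun x => by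
    rw [← LinearMap.comp_apply, ← LinearMap.baseChange_comp, ← exteriorPower.map_comp, hri,
      exteriorPower.map_id, LinearMap.baseChange_id, LinearMap.id_apply]
  have hdown : ∀ y : ⋀[A]^n (A ⊗[R] M),
      exteriorPower.map n (r.baseChange A) (exteriorPower.map n (i.baseChange A) y) = y := fun y => by
    rw [← LinearMap.comp_apply, ← exteriorPower.map_comp, ← LinearMap.baseChange_comp, hri,
      LinearMap.baseChange_id, exteriorPower.map_id, LinearMap.id_apply]
  constructor
  · rw [← LinearMap.ker_eq_bot, LinearMap.ker_eq_bot']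
    intro x hx
    have hx' : exteriorPowerBaseChange R A n F ((exteriorPower.map n i).baseChange A x) = 0 := by
      rw [h1, hx, map_zero]
    have hx'' : (exteriorPower.map n i).baseChange A x = 0 :=
      hF.1 (by rw [hx', map_zero])
    rw [← hup x, hx'', map_zero]
  · intro y
    obtain ⟨w, hw⟩ := hF.2 (exteriorPower.map n (i.baseChange A) y)
    refine ⟨(exteriorPower.map n r).baseChange A w, ?_⟩
    rw [h2, hw, hdown]

variable (R A n M)

/-- **Prop. 8 for projective modules: `θ : A ⊗_R ⋀ⁿ_R M → ⋀ⁿ_A (A ⊗_R M)` is bijective for every projective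
`R`-module `M`** and every commutative `R`-algebra `A` — a projective module is a retract of the free module
`M →₀ R` (Mathlib `Module.projective_def'`), for which ★ `exteriorPowerBaseChange_bijective` applies.
[cite: BourbakiAlgebraI1989, Ch. III §7 no. 5 Prop. 8] -/
theorem exteriorPowerBaseChange_bijective_of_projective [Module.Projective R M] :
    Bijective (exteriorPowerBaseChange R A n M) := by
  obtain ⟨s, hs⟩ := Module.projective_def'.mp (inferInstance : Module.Projective R M)
  exact exteriorPowerBaseChange_bijective_of_retract s (Finsupp.linearCombination R id) hs
    (exteriorPowerBaseChange_bijective R A (M →₀ R) n)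

end Retract

/-! ### §3 Exterior powers of projective modules are projective -/

section Projective

variable (R : Type*) [CommRing R] (n : ℕ) (M : Type*) [AddCommGroup M] [Module R M]

/-- **`⋀ⁿ_R M` is projective for `M` projective**: it is a retract of `⋀ⁿ_R (M →₀ R)` (functoriality of `⋀ⁿ`,
Mathlib `exteriorPower.map_comp`), which is free (Mathlib `exteriorPower.instFree`).
[cite: Bourbaki1989CommAlg, Ch. II §5 no. 3 (before formula (1): `⋀ᵏ E` is finite projective)] [cite: StacksProject, Tag 00DM] -/
theorem exteriorPower_projective [Module.Projective R M] : Module.Projective R (⋀[R]^n M) := by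
  obtain ⟨s, hs⟩ := Module.projective_def'.mp (inferInstance : Module.Projective R M)
  have h : exteriorPower.map n (Finsupp.linearCombination R id) ∘ₗ exteriorPower.map n s = LinearMap.id := by
    rw [← exteriorPower.map_comp, hs, exteriorPower.map_id]
  exact Module.Projective.of_split (exteriorPower.map n s)
    (exteriorPower.map n (Finsupp.linearCombination R (id : M → M))) h

end Projective

/-! ### §4 The rank of `⋀ⁿ M` at a prime -/

section Rank

variable (R : Type*) [CommRing R] (n : ℕ) (M : Type*) [AddCommGroup M] [Module R M]

/-- **`rankAtStalk (⋀ⁿ_R M) 𝔭 = (rankAtStalk M 𝔭).choose n` for `M` finite projective**: after base change to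
the local ring `R_𝔭` (§2: `R_𝔭 ⊗ ⋀ⁿ_R M ≅ ⋀ⁿ_{R_𝔭}(R_𝔭 ⊗ M)`), `R_𝔭 ⊗ M` is free of rank `rankAtStalk M 𝔭`
(Mathlib `Module.free_of_flat_of_isLocalRing`, `rankAtStalk_eq_finrank_tensorProduct`) and
`⋀ⁿ` of a free module of rank `r` is free of rank `r.choose n` (Mathlib `exteriorPower.finrank_eq`).
In particular the top exterior power `⋀ᵏ` of a finite projective module of constant rank `k` has constant rank
`k.choose k = 1`. [cite: Bourbaki1989CommAlg, Ch. II §5 no. 3, formula (5)] [cite: StacksProject, Tag 00DM] -/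
theorem rankAtStalk_exteriorPower [Module.Finite R M] [Module.Projective R M] (p : PrimeSpectrum R) :
    Module.rankAtStalk (⋀[R]^n M) p = (Module.rankAtStalk M p).choose n := by
  rw [Module.rankAtStalk_eq_finrank_tensorProduct, Module.rankAtStalk_eq_finrank_tensorProduct,
    (LinearEquiv.ofBijective _
      (exteriorPowerBaseChange_bijective_of_projective R (Localization.AtPrime p.asIdeal) n M)).finrank_eq]
  haveI : Module.Free (Localization.AtPrime p.asIdeal) (Localization.AtPrime p.asIdeal ⊗[R] M) :=
    Module.free_of_flat_of_isLocalRing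
  exact exteriorPower.finrank_eq _ _

/-- The constant-rank form: if `rankAtStalk M = k` (constant) then `rankAtStalk (⋀ⁿ_R M) = k.choose n`.
[cite: Bourbaki1989CommAlg, Ch. II §5 no. 3, formula (5)] -/
theorem rankAtStalk_exteriorPower_of_rankAtStalk_eq [Module.Finite R M] [Module.Projective R M] {k : ℕ}
    (hk : ∀ p, Module.rankAtStalk (R := R) M p = k) (p : PrimeSpectrum R) :
    Module.rankAtStalk (⋀[R]^n M) p = k.choose n := by
  rw [rankAtStalk_exteriorPower, hk]

/-- **The top exterior power of a finite projective module of constant rank `k` has constant rank `1`.**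
[cite: Bourbaki1989CommAlg, Ch. II §5 no. 3, formula (5)] -/
theorem rankAtStalk_exteriorPower_top [Module.Finite R M] [Module.Projective R M] {k : ℕ}
    (hk : ∀ p, Module.rankAtStalk (R := R) M p = k) (p : PrimeSpectrum R) :
    Module.rankAtStalk (⋀[R]^k M) p = 1 := by
  rw [rankAtStalk_exteriorPower_of_rankAtStalk_eq R k M hk, Nat.choose_self]

end Rank

end Literature.LinearAlgebra.Alternating

end
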